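import Summits.CriticalPhenomena.CardyFormulaZ2.Theorems.CardyIKTransportIKLinearTransportLine
import Literature.Probability.Percolation.TriThetaHalf
import Literature.Probability.LatticeModels.ProdBernoulliIndependence

/-!
# Stub `stub_ConditionalRSW` (line `pinned-diagram-exchange`, crux stmt-CriticalPhenomena-5076):
# audit record and the `S = ∅` member, proved

Helpers toward the registered stub
`stub_ConditionalRSW : ∃ c, 0 < c ∧ ∀ S n, 1 ≤ n → ∀ a b E, MeasurableSet E → CondRSWBound c S n a b E`
(conditional RSW for the column-mixed Izergin–Korepin family, uniform in the column pattern `S`).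
The stub itself is NOT closed here: for `S ≠ ∅` the colour field has no FKG and the uniform box-crossing
bound is route item r4 (stmt-CriticalPhenomena-5911), open. What this file proves, sorry-free:

* `condRSWBound_empty_of_law` — THE `S = ∅` MEMBER of the stub, for every `n ≥ 1`, every box position
  and every measurable far event `E`, with the colour-law identification of the neighbouring stub
  `stub_TriLawOfEmpty` taken as an explicit HYPOTHESIS `hLaw` (never as an axiom): at `S = ∅` all faces
  are anti (`crsw_antiSet_empty_eq`), the observables are `(blackSet ∅ ω, univ)` and the triangulation is the
  triangular lattice `triGraph` (diagonal `(1,-1)`); the long-way crossing events contain the tree's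
  site-`𝕋` parallelogram crossings `triHCross a b (2m+1) m` / `triVCross a b m (2m+1)`
  (`crsw_triHCross_subset_lrCross`, `crsw_triVCross_subset_tbCross`), whose `P_{1/2}`-probability is
  `triLRCrossingProb half (2m+1) m ≥ c₀ > 0` uniformly (`crsw_exists_le_triLRCrossingProb_long`, from the
  tree's RSW theorem `tri_rsw_half_holds` at aspect ratio `3` and width anti-monotonicity); an event
  determined by the far cells is independent of an event determined by the box
  (`prodBernoulli_real_inter_of_determinedBy`), so the conditioning is free.
* the audit lemmas of §1–§3 are general (`crsw_determinedBy_trace`, `crsw_openConnIn_of_pathIn`, …).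

AUDIT OF THE STUB (gen-1 worker, 2026-08-16; informal, recorded for the lead).
(1) Small `n`. `farFrom a b w h d = {v | v 0 < a-d ∨ a+w+d ≤ v 0 ∨ …}` is the set of cells at
sup-distance `> d` (not `≥ d`) from the box, so at `n = 1` the conditioning cells are at distance `≥ 2`
from the `2 × 1` box; either way the stub is NOT refuted at small `n`: every finite box marginal of the
gauge colour field `blackSet S` is EXACTLY the free corner field
`2^{-(m+k-1)} ∏_{internal faces f} π_f(odd_f)` (`π_f(1) = p_f`, `p_f = 2√3-3` on `S`-columns, `1/2`
elsewhere) — checked by exhaustive enumeration of the gauge bits for boxes at four positions incl.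
straddling the axes, generic rational `p`, 0 mismatches (scratch/audit_marginal.py) — hence the
colour field is a Markov field for the 4-body face specification, `P(σ_B = η | σ off B, coins) =
γ_B(η | ring)` a.s. by Lévy's upward theorem (the finite-volume conditionals do not depend on the
volume), and `γ_B ≥ 2^{-|B|} (√3/2)^{#faces touching B}`: for the `2 × 1` box `≥ 27/256`, for the
`2n × n` box `≥ 4^{-n²}(√3/2)^{(2n+1)(n+1)}`. Since "all box cells black" is a long-way crossing for
every diagonal configuration (horizontal/vertical neighbours are always `cellGraph`-adjacent) and the
coins are independent of the colours, `CondRSWBound c_n S n a b E` holds for EVERY `S`, `E` with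
`c_n = 4^{-n²}(√3/2)^{(2n+1)(n+1)}`; no far event forces a colour. The content of the stub is the
uniformity of `c` in `n` (and `S`) = RSW. (2) `E` ranges over measurable subsets of
`Obs = Set (Site 2) × Set (Site 2)` determined (combinatorially) by the far coordinates of BOTH
components; such an `E` is the preimage of its own section under the `σ(far)`-measurable restriction
map, so it lies in `σ(far colours, far coins)`; the far coins are independent fair bits on `S`-columns
and deterministic elsewhere — harmless. If `obs S` were not measurable `νmix S = 0` and the bound is
trivial, so measurability cannot falsify either. (3) The `n × 2n` clause is the transpose of the
`2n × n` clause (for `S = ∅` both reduce to `triLRCrossingProb half (2m+1) m` by the tree's reflection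
identity `triSitePercolation_real_triVCross`). VERDICT: not false, not mis-stated; open for `S ≠ ∅`
exactly as stmt-5911.
-/

noncomputable section

namespace Summit.CriticalPhenomena.CardyFormulaZ2.Theorems.IKLinearTransport.PinnedDiagramExchange

open scoped BigOperators Topology Classical MeasureTheory ProbabilityTheory ENNReal
open Filter Set Function MeasureTheory
open Literature.Probability.Percolation Literature.Probability.LatticeModels

/-! ## §1 The `S = ∅` observables: all faces anti, colours paired with `univ` -/

/-- Off `S` every face is anti: `antiSet ∅ ω = univ`. [folklore] -/
theorem crsw_antiSet_empty_eq (ω : Ω) : antiSet ∅ ω = Set.univ := by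
  ext f; simp [antiSet]

/-- The observables of the `S = ∅` member are `(blackSet ∅ ω, univ)`. [folklore] -/
theorem crsw_obs_empty_eq :
    obs (∅ : Set ℤ) = (fun A : Set (Site 2) => ((A, (Set.univ : Set (Site 2))) : Obs)) ∘ blackSet ∅ := by
  funext ω
  simp only [Function.comp_apply, obs, crsw_antiSet_empty_eq]

/-- Under the colour-law identification, `νmix ∅` is the image of fair site percolation under
`A ↦ (A, univ)`. [folklore] -/
theorem crsw_νmix_empty_eq_map
    (hLaw : Measurable (blackSet (∅ : Set ℤ)) ∧ μIK.map (blackSet ∅) = sitePercolation (Site 2) half) :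
    νmix ∅ = (sitePercolation (Site 2) half).map
      (fun A : Set (Site 2) => ((A, (Set.univ : Set (Site 2))) : Obs)) := by
  rw [νmix, crsw_obs_empty_eq, ← Measure.map_map measurable_prodMk_right hLaw.1, hLaw.2]

/-! ## §2 Events determined by a set of cells: the colour-level trace -/

/-- The colour-level trace `{A | (A, univ) ∈ E}` of an observable event determined by the cells of
`Λ` is determined by the sites of `Λ`. [folklore] -/
theorem crsw_determinedBy_trace {Λ : Set (Site 2)} {E : Set Obs} (hE : E ∈ determinedOn Λ) :
    DeterminedBy {A : Set (Site 2) | ((A, (Set.univ : Set (Site 2))) : Obs) ∈ E} Λ := by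
  rw [determinedBy_iff]
  intro ω ω' hω
  refine hE (ω, Set.univ) (ω', Set.univ) fun v hv => ⟨?_, Iff.rfl⟩
  have h := Set.ext_iff.1 hω v
  simp only [Set.mem_inter_iff, hv, and_true] at h
  exact h

/-- The colour-level trace of a measurable observable event is measurable. [folklore] -/
theorem crsw_measurableSet_trace {E : Set Obs} (hE : MeasurableSet E) :
    MeasurableSet {A : Set (Site 2) | ((A, (Set.univ : Set (Site 2))) : Obs) ∈ E} :=
  measurable_prodMk_right hE

/-! ## §3 Crossing geometry at `S = ∅`: site-`𝕋` paths are black-edge paths -/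

/-- The unit coordinate vectors of `ℤ²` in matrix notation. [folklore] -/
theorem crsw_single_eq_vec (i : Fin 2) :
    (Pi.single i (1 : ℤ) : Site 2) = ![1, 0] ∨ (Pi.single i (1 : ℤ) : Site 2) = ![0, 1] := by
  fin_cases i
  · left; ext j; fin_cases j <;> rfl
  · right; ext j; fin_cases j <;> rfl

/-- A `triGraph`-edge between two black cells is a black edge of the all-anti triangulation. [folklore] -/
theorem crsw_mem_blackEdges_univ {A : Set (Site 2)} {u v : Site 2} (h : triGraph.Adj u v) (hu : u ∈ A)
    (hv : v ∈ A) : s(u, v) ∈ blackEdges ((A, (Set.univ : Set (Site 2))) : Obs) := by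
  rcases (triGraph_adj_iff u v).1 h with h | h | h
  · obtain ⟨i, h | h⟩ := (zdGraph_adj_iff u v).1 h
    · rcases crsw_single_eq_vec i with hi | hi <;> rw [hi] at h
      · exact ⟨u, v, rfl, hu, hv, Or.inl h⟩
      · exact ⟨u, v, rfl, hu, hv, Or.inr (Or.inl h)⟩
    · rcases crsw_single_eq_vec i with hi | hi <;> rw [hi] at h
      · exact ⟨v, u, Sym2.eq_swap, hv, hu, Or.inl h⟩
      · exact ⟨v, u, Sym2.eq_swap, hv, hu, Or.inr (Or.inl h)⟩
  · exact ⟨u, v, rfl, hu, hv, Or.inr (Or.inr (Or.inr ⟨h, Set.mem_univ _⟩))⟩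
  · exact ⟨v, u, Sym2.eq_swap, hv, hu, Or.inr (Or.inr (Or.inr ⟨h, Set.mem_univ _⟩))⟩

/-- A site-`𝕋` path of black cells inside `B` is an open path of black edges inside `B`. [folklore] -/
theorem crsw_openConnIn_of_pathIn {A B : Set (Site 2)} {x y : Site 2} (h : PathIn triGraph (B ∩ A) x y) :
    blackEdges ((A, (Set.univ : Set (Site 2))) : Obs) ∈ openConnIn B x y := by
  obtain ⟨hx, hxy⟩ := h
  induction hxy with
  | refl => exact ⟨hx.1, hx.1, SimpleGraph.Reachable.refl _⟩
  | tail hab hbc ih =>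
    obtain ⟨hxB, hbB, hreach⟩ := ih
    have hbA := (PathIn.right_mem (G := triGraph) ⟨hx, hab⟩).2
    refine ⟨hxB, hbc.2.1, hreach.trans (SimpleGraph.Adj.reachable ?_)⟩
    rw [SimpleGraph.induce_adj, openGraph_adj]
    exact ⟨crsw_mem_blackEdges_univ hbc.1 hbA hbc.2.2, hbc.1.ne⟩

/-- The tree's horizontal crossing of the parallelogram `[a, a+2m+1] × [b, b+m]` is a black left–right
crossing of the `2(m+1) × (m+1)` box at `(a, b)` of the `S = ∅` member. [folklore] -/
theorem crsw_triHCross_subset_lrCross (a b : ℤ) (m : ℕ) :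
    triHCross a b (2 * m + 1) m ⊆
      {A : Set (Site 2) | ((A, (Set.univ : Set (Site 2))) : Obs) ∈ lrCross a b (2 * (m + 1)) (m + 1)} := by
  rintro A ⟨x, y, hx0, hy0, hpath⟩
  have hxS := hpath.left_mem.1
  have hyS := hpath.right_mem.1
  simp only [mem_triStrip] at hxS hyS
  simp only [Set.mem_setOf_eq, lrCross, mem_openCrossing_iff]
  refine ⟨x, ?_, y, ?_, crsw_openConnIn_of_pathIn (hpath.mono ?_)⟩
  · push_cast; omega
  · push_cast; omega
  · rintro v ⟨hv, hvA⟩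
    simp only [mem_triStrip] at hv
    refine ⟨?_, hvA⟩
    simp only [Set.mem_setOf_eq]
    push_cast; omega

/-- The tree's vertical crossing of the parallelogram `[a, a+m] × [b, b+2m+1]` is a black bottom–top
crossing of the `(m+1) × 2(m+1)` box at `(a, b)` of the `S = ∅` member. [folklore] -/
theorem crsw_triVCross_subset_tbCross (a b : ℤ) (m : ℕ) :
    triVCross a b m (2 * m + 1) ⊆
      {A : Set (Site 2) | ((A, (Set.univ : Set (Site 2))) : Obs) ∈ tbCross a b (m + 1) (2 * (m + 1))} := by
  rintro A ⟨x, y, hx1, hy1, hpath⟩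
  have hxS := hpath.left_mem.1
  have hyS := hpath.right_mem.1
  simp only [mem_triStrip] at hxS hyS
  simp only [Set.mem_setOf_eq, tbCross, mem_openCrossing_iff]
  refine ⟨x, ?_, y, ?_, crsw_openConnIn_of_pathIn (hpath.mono ?_)⟩
  · push_cast; omega
  · push_cast; omega
  · rintro v ⟨hv, hvA⟩
    simp only [mem_triStrip] at hv
    refine ⟨?_, hvA⟩
    simp only [Set.mem_setOf_eq]
    push_cast; omega

/-- The far cells of the `2n × n` box avoid the parallelogram `[a, a+2m+1] × [b, b+m]`, `n = m+1`. [folklore] -/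
theorem crsw_farFrom_subset_compl_stripH (a b : ℤ) (m : ℕ) :
    farFrom a b (2 * (m + 1)) (m + 1) (m + 1) ⊆ (↑(triStripFinset a b (2 * m + 1) m) : Set (Site 2))ᶜ := by
  intro v hv hv'
  rw [coe_triStripFinset, mem_triStrip] at hv'
  simp only [farFrom, Set.mem_setOf_eq] at hv
  push_cast at hv hv'
  omega

/-- The far cells of the `n × 2n` box avoid the parallelogram `[a, a+m] × [b, b+2m+1]`, `n = m+1`. [folklore] -/
theorem crsw_farFrom_subset_compl_stripV (a b : ℤ) (m : ℕ) :
    farFrom a b (m + 1) (2 * (m + 1)) (m + 1) ⊆ (↑(triStripFinset a b m (2 * m + 1)) : Set (Site 2))ᶜ := by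
  intro v hv hv'
  rw [coe_triStripFinset, mem_triStrip] at hv'
  simp only [farFrom, Set.mem_setOf_eq] at hv
  push_cast at hv hv'
  omega

/-! ## §4 Probability: RSW input, independence, assembly -/

/-- Uniform RSW lower bound for the long-way crossing of the `(2m+2) × (m+1)`-cell parallelograms of
site-`𝕋` at `p = 1/2` (the tree's `tri_rsw_half_holds` at aspect ratio `3`, width anti-monotonicity,
and positivity at `m = 0`). [folklore] -/
theorem crsw_exists_le_triLRCrossingProb_long :
    ∃ c : ℝ, 0 < c ∧ ∀ m : ℕ, c ≤ triLRCrossingProb half (2 * m + 1) m := by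
  obtain ⟨c, hc, h⟩ := tri_rsw_half_holds 3 (by norm_num)
  have hpos : 0 < triLRCrossingProb half 1 0 :=
    triLRCrossingProb_pos (p := half) (by norm_num [half]) 1 0
  refine ⟨min c (triLRCrossingProb half 1 0), lt_min hc hpos, fun m => ?_⟩
  rcases Nat.eq_zero_or_pos m with rfl | hm
  · exact min_le_right _ _
  · have hfloor : ⌊(3 : ℝ) * (m : ℝ)⌋₊ = 3 * m := by
      rw [show (3 : ℝ) * (m : ℝ) = ((3 * m : ℕ) : ℝ) by push_cast; ring, Nat.floor_natCast]
    have h3 := (h m (by rw [hfloor]; omega)).1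
    rw [hfloor] at h3
    exact (min_le_left _ _).trans (h3.trans (triLRCrossingProb_anti_width half (by omega) m))

/-- INDEPENDENCE STEP. If `H ⊆ C'` is determined by the finite set of sites `F` and has probability
`≥ c`, and the measurable event `E'` is determined by the sites off `F`, then
`c · P(E') ≤ P(E' ∩ C')` under fair site percolation. [folklore] -/
theorem crsw_real_inter_ge_of_determinedBy {F : Finset (Site 2)} {H C' E' : Set (Set (Site 2))}
    (hHF : DeterminedBy H ↑F) (hHC : H ⊆ C') (hE'F : DeterminedBy E' (↑F : Set (Site 2))ᶜ)
    (hE'm : MeasurableSet E') {c : ℝ} (hc : c ≤ (sitePercolation (Site 2) half).real H) :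
    c * (sitePercolation (Site 2) half).real E' ≤ (sitePercolation (Site 2) half).real (E' ∩ C') := by
  have hHm : MeasurableSet H := hHF.measurableSet_of_finset
  have hμ : sitePercolation (Site 2) half = prodBernoulli fun _ : Site 2 => half := by
    rw [prodBernoulli_const]; rfl
  have hind : (sitePercolation (Site 2) half).real (H ∩ E') =
      (sitePercolation (Site 2) half).real H * (sitePercolation (Site 2) half).real E' := by
    rw [hμ]
    exact prodBernoulli_real_inter_of_determinedBy (fun _ : Site 2 => half) F hHF hE'F hHm hE'm
  calc c * (sitePercolation (Site 2) half).real E'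
      ≤ (sitePercolation (Site 2) half).real H * (sitePercolation (Site 2) half).real E' :=
        mul_le_mul_of_nonneg_right hc measureReal_nonneg
    _ = (sitePercolation (Site 2) half).real (H ∩ E') := hind.symm
    _ ≤ (sitePercolation (Site 2) half).real (E' ∩ C') :=
        measureReal_mono (fun A hA => ⟨hA.2, hHC hA.1⟩) (measure_ne_top _ _)

/-- TRANSFER TO THE OBSERVABLES. A colour-level conditional bound for the traces gives the bound for
`νmix ∅` (equality on the measurable `E`, `le_map_apply` on `E ∩ C`). [folklore] -/
theorem crsw_νmix_empty_condBound_of_trace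
    (hLaw : Measurable (blackSet (∅ : Set ℤ)) ∧ μIK.map (blackSet ∅) = sitePercolation (Site 2) half)
    {E C : Set Obs} (hE : MeasurableSet E) {c : ℝ}
    (h : c * (sitePercolation (Site 2) half).real {A : Set (Site 2) | ((A, (Set.univ : Set (Site 2))) : Obs) ∈ E} ≤
      (sitePercolation (Site 2) half).real
        ({A : Set (Site 2) | ((A, (Set.univ : Set (Site 2))) : Obs) ∈ E} ∩
          {A : Set (Site 2) | ((A, (Set.univ : Set (Site 2))) : Obs) ∈ C})) :
    c * (νmix ∅).real E ≤ (νmix ∅).real (E ∩ C) := by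
  rw [crsw_νmix_empty_eq_map hLaw, measureReal_def, measureReal_def,
    Measure.map_apply measurable_prodMk_right hE]
  refine h.trans ?_
  refine ENNReal.toReal_mono (measure_ne_top _ _) ?_
  exact Measure.le_map_apply measurable_prodMk_right.aemeasurable (E ∩ C)

/-- THE `S = ∅` MEMBER OF `stub_ConditionalRSW`. Under the colour-law identification of the
neighbouring stub `stub_TriLawOfEmpty` (hypothesis `hLaw`: `blackSet ∅` is measurable and pushes the
gauge measure to fair site percolation), there is `c > 0` such that for every `n ≥ 1`, every box
position `(a, b)` and every measurable observable event `E`: if `E` is determined by the cells far from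
the `2n × n` (resp. `n × 2n`) box, then `c · ν_∅(E) ≤ ν_∅(E ∩ {black long-way crossing})`. Proof: the
crossing event contains the site-`𝕋` parallelogram crossing (probability `≥ c` by RSW on `𝕋`,
`crsw_exists_le_triLRCrossingProb_long`), which is independent of the far event. [folklore] -/
theorem condRSWBound_empty_of_law : (Measurable (blackSet (∅ : Set ℤ)) ∧ μIK.map (blackSet ∅) = sitePercolation (Site 2) half) →
    ∃ c : ℝ, 0 < c ∧ ∀ n : ℕ, 1 ≤ n → ∀ (a b : ℤ) (E : Set Obs), MeasurableSet E → CondRSWBound c ∅ n a b E := by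
  intro hLaw
  obtain ⟨c, hc, hcross⟩ := crsw_exists_le_triLRCrossingProb_long
  refine ⟨c, hc, fun n hn a b E hE => ?_⟩
  obtain ⟨m, rfl⟩ : ∃ m, n = m + 1 := ⟨n - 1, by omega⟩
  have hE' := crsw_measurableSet_trace hE
  constructor
  · intro hdet
    refine crsw_νmix_empty_condBound_of_trace hLaw hE ?_
    refine crsw_real_inter_ge_of_determinedBy (determinedBy_triHCross a b (2 * m + 1) m)
      (crsw_triHCross_subset_lrCross a b m)
      ((crsw_determinedBy_trace hdet).mono (crsw_farFrom_subset_compl_stripH a b m)) hE' ?_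
    have hP : (sitePercolation (Site 2) half).real (triHCross a b (2 * m + 1) m) =
        triLRCrossingProb half (2 * m + 1) m :=
      triSitePercolation_real_triHCross half a b (2 * m + 1) m
    rw [hP]
    exact hcross m
  · intro hdet
    refine crsw_νmix_empty_condBound_of_trace hLaw hE ?_
    refine crsw_real_inter_ge_of_determinedBy (determinedBy_triVCross a b m (2 * m + 1))
      (crsw_triVCross_subset_tbCross a b m)
      ((crsw_determinedBy_trace hdet).mono (crsw_farFrom_subset_compl_stripV a b m)) hE' ?_
    have hP : (sitePercolation (Site 2) half).real (triVCross a b m (2 * m + 1)) =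
        triLRCrossingProb half (2 * m + 1) m :=
      triSitePercolation_real_triVCross half a b m (2 * m + 1)
    rw [hP]
    exact hcross m

end Summit.CriticalPhenomena.CardyFormulaZ2.Theorems.IKLinearTransport.PinnedDiagramExchange
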